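import Mathlib
import Summits.NavierStokesRegularity.NavierStokesRegularity.Theorems.SubOnsagerCeilingDefs
import Summits.NavierStokesRegularity.NavierStokesRegularity.Theorems.SubOnsagerCeilingOrthantTailCeilingDyadicRatioTwoTools
import Summits.NavierStokesRegularity.NavierStokesRegularity.Theorems.SubOnsagerCeilingGapChain7
import Summits.NavierStokesRegularity.NavierStokesRegularity.Theorems.SubOnsagerCeilingGapSpecSliceL
import Summits.NavierStokesRegularity.NavierStokesRegularity.Theorems.SubOnsagerCeilingGapSpecSliceM
import HarnessLib

/-!
# RUNG 16 under the crux `SubOnsagerCeiling.ForwardTailCeilingKP` (stmt-NavierStokesRegularity-27057):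
# the ν-uniform shell barrier for scaled dyadic tables at EVERY scale ratio `1 + ε₀ ∈ [69/50, 2]`
# (helper file, `--supports`; LEAD g12; two more slices of the 13-face ratio-cap topology (per-pair κ) glued with the landed range `[7/5, 2]`)

**What is proved.** The one-mode chain bound `(b^(101/200))^(2k) Z_k(t)² ≤ 100 x₀²` at every `b ∈ [69/50, 25/16]`
(`VirtualFloor.GapRung.gap_chain8`: the new slices `[69/50, 139/100]` (`spec_gap_chain_M`), `[139/100, 7/5]` (`spec_gap_chain_L`) — designs `dM`, `dL : Fin 13 → GapSpec.Spec` of the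
13-face topology «d45 + three ratio caps» with per-pair κ (κ₀ for the bottom pair), fitted per slice by `sfit.py`/`descend.py` and certified in the
kernel (`SubOnsagerCeilingGapSpecCert*`, `…GapSpecSlice*`) — glued with `gap_chain7`); the lattice wrapper
`dyadicGapRange8_shellBarrier` (`ε₀ ∈ [19/50, 2/5]`), `dyadicGapRange8_shellBarrierAt`, `dyadicGapRange8Wide_shellBarrierAt`:
`ShellBarrierAt R ε₀ α` (`θ = 101/200`, `D = 100`) for every scaled dyadic table at EVERY `ε₀ ∈ [19/50, 1]` — the Katz–Pavlović
chain at every `b ∈ [1.38, 2]`.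
HONEST FRAMING: a statement about MODEL lattice ODEs (route SubOnsagerCeiling, rung TL-M2Break); one-mode chain class only; nothing here
bears on Navier–Stokes regularity and no crux or summit is proved. [cite: BarbatoMorandinRomito2011, §2 Lemma 2.1, §3.2]
[cite: Tao2016AveragedNS, §4 (4.5), (4.13)]
-/

noncomputable section

-- the sub-problem namespace `NavierStokesRegularity.NavierStokesRegularity` is the tree's layout (D-0017)
set_option linter.dupNamespace false

namespace Summit.NavierStokesRegularity.NavierStokesRegularity.Theorems

open Set Filter
open scoped Topology
open Literature.Analysis.FluidPDE.TaoCascade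
open Literature.Barriers.NavierStokesRegularity.Dyadic
open Summit.NavierStokesRegularity.NavierStokesRegularity.Theorems.SubOnsagerCeiling

/-- **The chain barrier `θ = 101/200` at every `b ∈ [69/50, 25/16]`.** [cite: BarbatoMorandinRomito2011, §3.2] -/
theorem VirtualFloor.GapRung.gap_chain8 {b c₀ ν s x₀ : ℝ} (hb : (69 : ℝ) / 50 ≤ b) (hb' : b ≤ (25 : ℝ) / 16) (hc₀ : 0 < c₀)
    (hν : 0 < ν) (hs : 0 < s) {Z : ℤ → ℝ → ℝ}
    (hdat : ∀ k : ℤ, Z k 0 = if k = 0 then x₀ else 0)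
    (hvan : ∀ t, Z (-1) t = 0)
    (hbdd : ∃ M : ℝ, ∀ (t : ℝ) (k : ℕ), (1 + b ^ ((10 : ℝ) * k)) * |Z k t| ≤ M)
    (hcont : ∀ k : ℕ, ContinuousOn (Z k) (Icc 0 s))
    (hode : ∀ k : ℕ, ∀ t ∈ Icc 0 s, HasDerivWithinAt (Z k)
      (c₀ * (b ^ ((5 : ℝ) * ((k : ℝ) - 1) / 2) * Z ((k : ℤ) - 1) t ^ 2 -
          b ^ ((5 : ℝ) * (k : ℝ) / 2) * (Z k t * Z ((k : ℤ) + 1) t)) -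
        ν * b ^ ((2 : ℝ) * (k : ℝ)) * Z k t) (Icc 0 s) t)
    (hnn : ∀ t ∈ Icc 0 s, ∀ k : ℕ, 1 ≤ k → 0 ≤ Z k t) :
    ∀ t ∈ Icc 0 s, ∀ k : ℕ, (b ^ ((101 : ℝ) / 200)) ^ (2 * k) * Z k t ^ 2 ≤ 100 * x₀ ^ 2 := by
  rcases le_or_gt b ((139 : ℝ) / 100) with h | h
  · exact VirtualFloor.GapSpec.spec_gap_chain_M hb h hc₀ hν hs hdat hvan hbdd hcont hode hnn
  have hb := h.le
  rcases le_or_gt b ((7 : ℝ) / 5) with h | h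
  · exact VirtualFloor.GapSpec.spec_gap_chain_L hb h hc₀ hν hs hdat hvan hbdd hcont hode hnn
  have hb := h.le
  exact VirtualFloor.GapRung.gap_chain7 hb hb' hc₀ hν hs hdat hvan hbdd hcont hode hnn

/-- **The ν-uniform shell barrier for scaled dyadic tables at every scale ratio `1+ε₀ ∈ [69/50, 7/5]`**
(`θ = 101/200`, `D = 100`, uniformly in `ν > 0`, in the scale `c > 0`, in `ε₀ ∈ [19/50, 2/5]` and in the datum).
[cite: BarbatoMorandinRomito2011, §2 Lemma 2.1 and §3.2] -/
theorem dyadicGapRange8_shellBarrier {c ε₀ : ℝ} (hc : 0 < c) (hε : (19 : ℝ) / 50 ≤ ε₀) (hε1 : ε₀ ≤ (2 : ℝ) / 5)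
    {α : Fin 4 → Fin 4 → Fin 4 → ℤ × ℤ × ℤ → ℝ}
    (hα : ∀ (i₁ i₂ i₃ : Fin 4) (μ : ℤ × ℤ × ℤ), α i₁ i₂ i₃ μ = c * dyadicTable i₁ i₂ i₃ μ) :
    ∀ ν : ℝ, 0 < ν → ∀ (X₀ : Fin 4 → ℝ) (s : ℝ), 0 < s → ∀ X : Fin 4 → ℤ → ℝ → ℝ,
      (∀ (i : Fin 4) (k : ℤ), X i k 0 = if k = 0 then X₀ i else 0) →
      (∀ (i : Fin 4) (k : ℤ), k < 0 → ∀ t : ℝ, X i k t = 0) →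
      (∃ M : ℝ, ∀ (t : ℝ) (i : Fin 4) (k : ℤ), (1 + (1 + ε₀) ^ ((10 : ℝ) * k)) * |X i k t| ≤ M) →
      (∀ (i : Fin 4) (k : ℤ), Continuous (X i k)) →
      (∀ (i : Fin 4) (k : ℤ), ∀ t ∈ Set.Icc (0 : ℝ) s, HasDerivWithinAt (X i k)
        (quadTerm ε₀ α X i k t - ν * (1 + ε₀) ^ ((2 : ℝ) * k) * X i k t) (Set.Icc (0 : ℝ) s) t) →
      (∀ t ∈ Set.Icc (0 : ℝ) s, ∀ (i : Fin 4) (k : ℤ), 1 ≤ k → 0 ≤ X i k t) →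
      ∀ t ∈ Set.Icc (0 : ℝ) s, ∀ (i : Fin 4) (k : ℕ),
        (1 + ε₀) ^ (2 * (101 / 200) * (k : ℝ)) * ((1 / 2 : ℝ) * X i (k : ℤ) t ^ 2) ≤
          100 * (∑ j : Fin 4, (1 / 2 : ℝ) * X₀ j ^ 2) := by
  intro ν hν X₀ s hs X hdat hvan hbdd hcont hode hnn t ht i k
  set b : ℝ := 1 + ε₀ with hb
  have hb17 : (69 : ℝ) / 50 ≤ b := by rw [hb]; linarith
  have hb2 : b ≤ (25 : ℝ) / 16 := by rw [hb]; linarith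
  have hb0 : 0 < b := by linarith
  set E₀ : ℝ := ∑ j : Fin 4, (1 / 2 : ℝ) * X₀ j ^ 2 with hE₀
  have hE₀i : ∀ j : Fin 4, (1 / 2 : ℝ) * X₀ j ^ 2 ≤ E₀ := fun j =>
    Finset.single_le_sum (f := fun j => (1 / 2 : ℝ) * X₀ j ^ 2) (fun j _ => by positivity)
      (Finset.mem_univ j)
  have hE₀0 : 0 ≤ E₀ := Finset.sum_nonneg fun j _ => by positivity
  have hw0 : 0 ≤ b ^ (2 * (101 / 200) * (k : ℝ)) := Real.rpow_nonneg hb0.le _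
  by_cases hi : i = 0
  swap
  · -- components `i ≠ 0`: pure decay, `X²` does not increase
    have hd : ∀ τ ∈ Icc 0 s, HasDerivWithinAt (fun r => X i k r ^ 2)
        (2 * X i k τ * (0 - ν * b ^ ((2 : ℝ) * (k : ℤ)) * X i k τ)) (Icc 0 s) τ := by
      intro τ hτ
      have h := hode i k τ hτ
      rw [dyadicRatioTwo_quadTerm_of_ne hα X hi] at h
      exact hasDerivWithinAt_sq h
    have hle := le_add_mul_of_deriv_le_Icc hd (C := 0) (fun τ _ => by
      have hw : 0 ≤ ν * b ^ ((2 : ℝ) * (k : ℤ)) := mul_nonneg hν.le (Real.rpow_nonneg hb0.le _)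
      nlinarith [sq_nonneg (X i k τ)]) t ht
    rw [zero_mul, add_zero, hdat i k] at hle
    rcases Nat.eq_zero_or_pos k with rfl | hk
    · simp only [Nat.cast_zero, mul_zero, Real.rpow_zero, one_mul, if_true] at hle ⊢
      calc (1 / 2 : ℝ) * X i 0 t ^ 2 ≤ (1 / 2 : ℝ) * X₀ i ^ 2 := by linarith
        _ ≤ E₀ := hE₀i i
        _ ≤ 100 * E₀ := by linarith
    · rw [if_neg (by exact_mod_cast hk.ne')] at hle
      have hX0 : X i k t ^ 2 = 0 := le_antisymm (by simpa using hle) (sq_nonneg _)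
      rw [hX0, mul_zero, mul_zero]
      exact mul_nonneg (by norm_num) hE₀0
  -- component `0`: the Katz–Pavlović chain at ratio `b ∈ [69/50, 7/5]`
  subst hi
  have hdat' : ∀ k : ℤ, X 0 k 0 = if k = 0 then X₀ 0 else 0 := fun k => hdat 0 k
  have hvan' : ∀ τ, X 0 (-1) τ = 0 := fun τ => hvan 0 (-1) (by norm_num) τ
  have hbdd' : ∃ M : ℝ, ∀ (τ : ℝ) (k : ℕ), (1 + b ^ ((10 : ℝ) * k)) * |X 0 k τ| ≤ M := by
    obtain ⟨M, hM⟩ := hbdd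
    exact ⟨M, fun τ k => by simpa using hM τ 0 k⟩
  have hcont' : ∀ k : ℕ, ContinuousOn (X 0 k) (Icc 0 s) := fun k => (hcont 0 k).continuousOn
  have hode' : ∀ (m : ℕ), ∀ τ ∈ Icc 0 s, HasDerivWithinAt (X 0 m)
      (c * (b ^ ((5 : ℝ) * ((m : ℝ) - 1) / 2) * X 0 ((m : ℤ) - 1) τ ^ 2 -
          b ^ ((5 : ℝ) * (m : ℝ) / 2) * (X 0 m τ * X 0 ((m : ℤ) + 1) τ)) -
        ν * b ^ ((2 : ℝ) * (m : ℝ)) * X 0 m τ) (Icc 0 s) τ := by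
    intro m τ hτ
    have h := hode 0 (m : ℤ) τ hτ
    rw [dyadicRatioTwo_quadTerm_const_mul hα, quadTerm_dyadicTable_zero] at h
    push_cast at h
    exact h
  have hnn' : ∀ τ ∈ Icc 0 s, ∀ k : ℕ, 1 ≤ k → 0 ≤ X 0 k τ := fun τ hτ k hk =>
    hnn τ hτ 0 k (by exact_mod_cast hk)
  have key := VirtualFloor.GapRung.gap_chain8 hb17 hb2 hc hν hs hdat' hvan' hbdd' hcont' hode' hnn' t ht k
  -- `(1+ε₀)^{2θk} = (b^θ)^{2k}`
  have hw : b ^ (2 * (101 / 200) * (k : ℝ)) = (b ^ ((101 : ℝ) / 200)) ^ (2 * k) := by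
    rw [← Real.rpow_mul_natCast hb0.le]
    congr 1; push_cast; ring
  rw [hw]
  calc (b ^ ((101 : ℝ) / 200)) ^ (2 * k) * ((1 / 2 : ℝ) * X 0 (k : ℤ) t ^ 2)
      = (1 / 2 : ℝ) * ((b ^ ((101 : ℝ) / 200)) ^ (2 * k) * X 0 (k : ℤ) t ^ 2) := by ring
    _ ≤ (1 / 2 : ℝ) * (100 * X₀ 0 ^ 2) := by linarith
    _ = 100 * ((1 / 2 : ℝ) * X₀ 0 ^ 2) := by ring
    _ ≤ 100 * E₀ := by linarith [hE₀i 0]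

/-- **`ShellBarrierAt R ε₀ α` for every scaled dyadic table at every `ε₀ ∈ [19/50, 2/5]`**
(`θ = 101/200`, `D = 100`). [cite: BarbatoMorandinRomito2011, §2 Lemma 2.1 and §3.2] -/
theorem dyadicGapRange8_shellBarrierAt : ∀ R : ℝ, ∀ ε₀ : ℝ, (19 : ℝ) / 50 ≤ ε₀ → ε₀ ≤ (2 : ℝ) / 5 →
    ∀ α : Fin 4 → Fin 4 → Fin 4 → ℤ × ℤ × ℤ → ℝ, IsScaledDyadic α → ShellBarrierAt R ε₀ α := by
  intro R ε₀ hε hε1 α hα _hT _hO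
  obtain ⟨c, hc, hα⟩ := hα
  exact ⟨101 / 200, by norm_num, 100, by norm_num, dyadicGapRange8_shellBarrier hc hε hε1 hα⟩

/-- **`ShellBarrierAt R ε₀ α` for every scaled dyadic table at EVERY `ε₀ ∈ [19/50, 1]`** — glued with
`dyadicGapRange7Wide_shellBarrierAt`: the chain at every scale ratio `b ∈ [1.38, 2]`. [cite: BarbatoMorandinRomito2011, §2 Lemma 2.1 and §3.2] -/
theorem dyadicGapRange8Wide_shellBarrierAt : ∀ R : ℝ, ∀ ε₀ : ℝ, (19 : ℝ) / 50 ≤ ε₀ → ε₀ ≤ 1 →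
    ∀ α : Fin 4 → Fin 4 → Fin 4 → ℤ × ℤ × ℤ → ℝ, IsScaledDyadic α → ShellBarrierAt R ε₀ α := by
  intro R ε₀ hε hε1 α hα
  rcases le_or_gt ε₀ ((2 : ℝ) / 5) with h | h
  · exact dyadicGapRange8_shellBarrierAt R ε₀ hε h α hα
  · exact dyadicGapRange7Wide_shellBarrierAt R ε₀ h.le hε1 α hα

end Summit.NavierStokesRegularity.NavierStokesRegularity.Theorems

end
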